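import Summits.RiemannHypothesis.RiemannHypothesis.Theorems.GroundBartaEvenWinsBeyondArchDeflationWindowImageSplit
import Literature.Analysis.ValidatedNumerics.TaylorModelContract
import Literature.Analysis.ValidatedNumerics.TaylorModelEdgePanel
import Literature.Analysis.ValidatedNumerics.TaylorModelPartial
import Literature.Analysis.ValidatedNumerics.TaylorModelSymmDiff
import Literature.Analysis.ValidatedNumerics.TaylorModelMovingIntegral
import Literature.NumberTheory.LFunctions.WeilArchDensityPanels
import Literature.NumberTheory.LFunctions.WeilArchTailPanels
import HarnessLib

/-!
# RiemannHypothesis / GroundBarta — rung 4 (`EvenWinsBeyondArch`, stmt-RiemannHypothesis-18807 / 18085):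
# the deflated Temple L-side, XVI′ — the archimedean part of the window image from LOCAL TABLES (kernel-feasible v2)

Helper file (`--supports stmt-RiemannHypothesis-18807`), RH-free, Mathlib + landed tree files only, no facts.  Prover B,
speedrun unit `sr-gb-rung-b` (gen 4).  Replaces file XVI (`dt_archSplitTM`, exact bivariate moving integrals — correct but not
kernel-evaluable at production size, R-LAYER.md §10).

For the `k`-th y-panel (`y = y_k + ρ`, `|ρ| ≤ h`, `h = c/(2m)`, `k + 2 ≤ m`) the two arch integrals of `dt_archImage_split`,

  `E(ρ) = ∫_{(0, c−y]} G(t)·(2g(y) − g(y−t) − g(y+t))/t dt`,   `H(ρ) = ∫_{(c−y, c+y]} G(t)·(g(y) − g(y−t))/t dt`,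

are enclosed by Taylor models built ONLY from: the exact local expansion of `g` at `y_k` (panel 0, `tmem_panel0`), the local
Taylor TABLE of `g` at the even grid points `2nh` (`TabOK`, contracted against the moments of `ρ(t_i + u)` on each t-panel,
`tmem_contrI`; partial panels `tmem_partVar` / `tmem_partConst`), the panel models of `ρ` and their moments.
Main results: `dt_tmem_archE`, `dt_tmem_archH`.

References: E. Bombieri, Rend. Mat. Acc. Lincei (9) 11 (2000) Thm 2 [Bombieri2000Weil]; K. Makino, M. Berz (2003).

-/

set_option linter.dupNamespace false

noncomputable section

open MeasureTheory Set Filter intervalIntegral Finset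
open scoped Topology BigOperators

namespace Summit.RiemannHypothesis.RiemannHypothesis.Theorems.EvenWinsBeyondArch

open Literature.NumberTheory.LFunctions
open Literature.Analysis.ValidatedNumerics Literature.Analysis.ValidatedNumerics.PolyMP
  Literature.Analysis.ValidatedNumerics.NumericsMP Literature.Analysis.ValidatedNumerics.ExpPoly

/-! ## Small Taylor-model helpers -/



/-- `Σ_{i<N} a i = a 0 + Σ_{i<N, 1 ≤ i} a i` for `N ≥ 1`. -/
theorem dt_sum_range_split0 {M : Type*} [AddCommMonoid M] (a : ℕ → M) {N : ℕ} (hN : 1 ≤ N) :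
    ∑ i ∈ Finset.range N, a i = a 0 + ∑ i ∈ (Finset.range N).filter (fun i ↦ 1 ≤ i), a i := by
  have h0 : (0 : ℕ) ∈ Finset.range N := Finset.mem_range.2 (by omega)
  rw [← Finset.add_sum_erase _ _ h0]
  congr 1
  refine Finset.sum_congr ?_ fun _ _ ↦ rfl
  ext i
  simp only [Finset.mem_erase, Finset.mem_filter, Finset.mem_range]
  omega

/-! ## Grid bookkeeping -/

section Grid

variable {c : ℚ} {m k : ℕ}
/-- `h = c/(2m) > 0`. -/
theorem dt_h_pos (hc : 0 < c) (hm : 0 < m) : (0 : ℝ) < ((c / (2 * m) : ℚ) : ℝ) := by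
  have : (0 : ℚ) < m := by exact_mod_cast hm
  exact_mod_cast (by positivity : (0 : ℚ) < c / (2 * m))
/-- `t_i = (2i+1) h` over `ℝ`. -/
theorem dt_tI_eq (h : ℚ) (i : ℕ) : ((PolyMP.panelCentre h i : ℚ) : ℝ) = (2 * i + 1) * (h : ℝ) := by
  simp only [PolyMP.panelCentre]; push_cast; ring
/-- base points: `2(k − i)h = t_k − t_i` and `2(k + i + 1)h = t_k + t_i`. -/
theorem dt_base_minus (h : ℚ) (k i : ℕ) :
    (2 * (((k : ℤ) - i : ℤ) : ℝ) * (h : ℝ)) = ((PolyMP.panelCentre h k : ℚ) : ℝ) - ((PolyMP.panelCentre h i : ℚ) : ℝ) := by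
  rw [dt_tI_eq, dt_tI_eq]; push_cast; ring
/-- base point on the far side: `2(k + i + 1)h = t_k + t_i`. -/
theorem dt_base_plus (h : ℚ) (k i : ℕ) :
    (2 * (((k : ℤ) + i + 1 : ℤ) : ℝ) * (h : ℝ)) = ((PolyMP.panelCentre h k : ℚ) : ℝ) + ((PolyMP.panelCentre h i : ℚ) : ℝ) := by
  rw [dt_tI_eq, dt_tI_eq]; push_cast; ring
/-- `c − y_k = t_{m−1−k}` on the grid `h = c/(2m)`, `k < m`. -/
theorem dt_c_sub_y0 (hk : k < m) :
    (c : ℝ) - ((PolyMP.panelCentre (c / (2 * m)) k : ℚ) : ℝ) = ((PolyMP.panelCentre (c / (2 * m)) (m - 1 - k) : ℚ) : ℝ) := by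
  have hm0 : 0 < m := by omega
  have hm : (m : ℝ) ≠ 0 := by exact_mod_cast hm0.ne'
  have hsub : ((m - 1 - k : ℕ) : ℝ) = (m : ℝ) - 1 - k := by
    rw [Nat.sub_sub, Nat.cast_sub (by omega)]; push_cast; ring
  rw [dt_tI_eq, dt_tI_eq, hsub]; push_cast; field_simp; ring
/-- `c + y_k = t_{m+k}`. -/
theorem dt_c_add_y0 (hm : 0 < m) :
    (c : ℝ) + ((PolyMP.panelCentre (c / (2 * m)) k : ℚ) : ℝ) = ((PolyMP.panelCentre (c / (2 * m)) (m + k) : ℚ) : ℝ) := by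
  have hm' : (m : ℝ) ≠ 0 := by positivity
  rw [dt_tI_eq, dt_tI_eq]; push_cast; field_simp; ring

end Grid

/-! ## Kernel facts on the t-panels `i ≥ 1` -/

section KernelPanels

variable {c : ℚ} {m : ℕ}
/-- `K_i(u) = ρ(t_i + u)` is continuous on `[-h, h]` for `i ≥ 1`. -/
theorem dt_continuousOn_K (hc : 0 < c) (hm : 0 < m) {i : ℕ} (hi : 1 ≤ i) :
    ContinuousOn (fun u : ℝ ↦ weilArchDensity (((PolyMP.panelCentre (c / (2 * m)) i : ℚ) : ℝ) + u))
      (Icc (-((c / (2 * m) : ℚ) : ℝ)) ((c / (2 * m) : ℚ) : ℝ)) := by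
  have hh := dt_h_pos hc hm
  refine continuousOn_weilArchDensity.comp (by fun_prop) fun u hu ↦ ?_
  simp only [Set.mem_Ioi]
  rw [dt_tI_eq]
  have : (1 : ℝ) ≤ i := by exact_mod_cast hi
  nlinarith [hu.1]
/-- `K_i` is interval integrable on `[-h, h]`, `i ≥ 1`. -/
theorem dt_intervalIntegrable_K (hc : 0 < c) (hm : 0 < m) {i : ℕ} (hi : 1 ≤ i) :
    IntervalIntegrable (fun u : ℝ ↦ weilArchDensity (((PolyMP.panelCentre (c / (2 * m)) i : ℚ) : ℝ) + u)) volume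
      (-((c / (2 * m) : ℚ) : ℝ)) ((c / (2 * m) : ℚ) : ℝ) :=
  (dt_continuousOn_K hc hm hi).intervalIntegrable_of_Icc (by linarith [dt_h_pos hc hm])
/-- `K_i ≥ 0` on `[-h, h]`, `i ≥ 1`. -/
theorem dt_K_nonneg (hc : 0 < c) (hm : 0 < m) {i : ℕ} (hi : 1 ≤ i) :
    ∀ u ∈ Icc (-((c / (2 * m) : ℚ) : ℝ)) ((c / (2 * m) : ℚ) : ℝ),
      0 ≤ weilArchDensity (((PolyMP.panelCentre (c / (2 * m)) i : ℚ) : ℝ) + u) := by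
  intro u hu
  have hh := dt_h_pos hc hm
  refine (weilArchDensity_pos ?_).le
  rw [dt_tI_eq]
  have : (1 : ℝ) ≤ i := by exact_mod_cast hi
  nlinarith [hu.1]
/-- `t_i + u > 0` on `[-h, h]` for `i ≥ 1`. -/
theorem dt_tI_add_pos (hc : 0 < c) (hm : 0 < m) {i : ℕ} (hi : 1 ≤ i) {u : ℝ}
    (hu : -((c / (2 * m) : ℚ) : ℝ) ≤ u) : 0 < ((PolyMP.panelCentre (c / (2 * m)) i : ℚ) : ℝ) + u := by
  have hh := dt_h_pos hc hm
  rw [dt_tI_eq]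
  have : (1 : ℝ) ≤ i := by exact_mod_cast hi
  nlinarith
/-- `G(t)·(X/t) = ρ(t)·X` for `t > 0`. -/
theorem dt_G_mul_div {t : ℝ} (ht : 0 < t) (X : ℝ) : weilArchDensityG t * (X / t) = weilArchDensity t * X := by
  rw [weilArchDensityG_of_ne ht.ne']; field_simp

end KernelPanels

/-! ## The E-part -/

section ArchE

variable {S : ℕ} {c : ℚ} {m k Dl : ℕ} {g : ℝ → ℝ}

/-- The Taylor model of the E-part (panel 0 exact, full panels `1 ≤ i < jn` by contraction, partial panel `jn`). -/
def dt_archETM (S : ℕ) (c : ℚ) (m k Dl : ℕ) (A0 : IPoly) (M0 : List MI) (Gy : IPoly)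
    (tab : ℤ → IPoly × ℤ × ℤ) (mu : ℕ → List MI) (W : ℕ → IPoly) (pw : ℕ → Poly) : IPoly :=
  let h : ℚ := c / (2 * m)
  let jn := m - 1 - k
  let m0 : ℕ → MI := fun i ↦ (mu i).getD 0 default
  let contrW : ℤ → ℕ → ℤ → IPoly := fun n i sgn ↦
    widen0 (contrI S (tab n).1 (mu i) sgn) ⌈(((tab n).2.1 * (m0 i).hi : ℤ) : ℚ) / S⌉
  let partVarW : ℤ → ℕ → ℤ → ℤ → IPoly := fun n i sgn τ ↦
    widen0 (partVarI S h (tab n).1 (pw i) sgn τ)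
      ⌈((((tab n).2.1 * (m0 i).hi : ℤ) : ℚ) +
        2 * h * ((tabsI S h (tsubI (W i) (ratPolyI S (pw i))) * (tab n).2.2 : ℤ) : ℚ)) / S⌉
  let full := (List.range jn).foldl (fun acc i ↦ if 1 ≤ i then
      taddI acc (tsubI (tsubI (tsmulI S (m0 i) (tsmulInt 2 Gy)) (contrW ((k : ℤ) - i) i (-1)))
        (contrW ((k : ℤ) + i + 1) i 1)) else acc) (panel0I S A0 M0)
  taddI full (tsubI (tsubI (tsmulInt 2 (tmulI S h Dl Gy (partConstI S h (W jn) (pw jn) (-1))))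
    (partVarW ((k : ℤ) - jn) jn (-1) (-1))) (partVarW ((k : ℤ) + jn + 1) jn 1 (-1)))

/-- **The E-part of the arch integral, enclosed from local tables** (`k + 2 ≤ m`).  Hypotheses: exact local expansion of `g`
at `y_k` (`A0`, panel 0) and its panel model `Gy`; the even-grid table `tab n` of `g` at `2nh` (`|n| ≤ m`, tables of length
`Dl + 1`, radius `2h`); `g` continuous; panel models `W i` (references `pw i`) of `ρ(t_i + ·)` and their moments `mu i` up to
order `Dl`, `1 ≤ i < 2m`; G-moments `M0` on `[0, 2h]`.
[cite: Bombieri2000Weil, Thm 2 (archimedean term)] -/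
theorem dt_tmem_archE (hS : 0 < S) (hc : 0 < c) (hkm : k + 2 ≤ m) (hg : Continuous g)
    {as0 : List ℝ} {A0 : IPoly} (has0 : PMem S as0 A0)
    (hexp0 : ∀ s, g (((PolyMP.panelCentre (c / (2 * m)) k : ℚ) : ℝ) + s) = evalR as0 s)
    {Gy : IPoly} (hGy : TMem S (c / (2 * m)) (fun s ↦ g (((PolyMP.panelCentre (c / (2 * m)) k : ℚ) : ℝ) + s)) Gy)
    {tab : ℤ → IPoly × ℤ × ℤ}
    (htab : ∀ n : ℤ, -(m : ℤ) ≤ n → n ≤ m →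
      TabOK S (2 * (c / (2 * m))) (fun s ↦ g (2 * (n : ℝ) * ((c / (2 * m) : ℚ) : ℝ) + s)) (tab n).1 (tab n).2.1 (tab n).2.2)
    (htabl : ∀ n : ℤ, -(m : ℤ) ≤ n → n ≤ m → (tab n).1.length = Dl + 1)
    {W : ℕ → IPoly} (hW : ∀ i, 1 ≤ i → i < 2 * m →
      TMem S (c / (2 * m)) (fun u ↦ weilArchDensity (((PolyMP.panelCentre (c / (2 * m)) i : ℚ) : ℝ) + u)) (W i))
    (pw : ℕ → Poly) {mu : ℕ → List MI}
    (hmu : ∀ i, 1 ≤ i → i < 2 * m → ∀ b, b < Dl + 1 →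
      MI.mem S (∫ u in (-((c / (2 * m) : ℚ) : ℝ))..((c / (2 * m) : ℚ) : ℝ),
        weilArchDensity (((PolyMP.panelCentre (c / (2 * m)) i : ℚ) : ℝ) + u) * u ^ b) ((mu i).getD b default))
    {M0 : List MI} (hM0 : ∀ j, j + 1 < A0.length →
      MI.mem S (∫ t in (0 : ℝ)..(2 * ((c / (2 * m) : ℚ) : ℝ)), weilArchDensityG t * t ^ j) (M0.getD j default)) :
    TMem S (c / (2 * m)) (fun ρ ↦ ∫ t in Ioc 0 ((c : ℝ) - ((((PolyMP.panelCentre (c / (2 * m)) k : ℚ) : ℝ) + ρ))),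
        weilArchDensityG t * ((2 * g (((PolyMP.panelCentre (c / (2 * m)) k : ℚ) : ℝ) + ρ) -
          g (((PolyMP.panelCentre (c / (2 * m)) k : ℚ) : ℝ) + ρ - t) -
          g (((PolyMP.panelCentre (c / (2 * m)) k : ℚ) : ℝ) + ρ + t)) / t))
      (dt_archETM S c m k Dl A0 M0 Gy tab mu W pw) := by
  -- notation
  set h : ℚ := c / (2 * m) with hh
  have hm : 0 < m := by omega
  have hk : k < m := by omega
  have hhr : (0 : ℝ) < h := dt_h_pos hc hm
  have hhr' : (0 : ℚ) ≤ h := by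
    have : (0 : ℚ) < m := by exact_mod_cast hm
    rw [hh]; positivity
  set y0 : ℝ := ((PolyMP.panelCentre h k : ℚ) : ℝ) with hy0
  set tI : ℕ → ℝ := fun i ↦ ((PolyMP.panelCentre h i : ℚ) : ℝ) with htI
  set jn := m - 1 - k with hjn
  have hjn1 : 1 ≤ jn := by omega
  have hjn2 : jn < 2 * m := by omega
  set K : ℕ → ℝ → ℝ := fun i u ↦ weilArchDensity (tI i + u) with hK
  set m0r : ℕ → ℝ := fun i ↦ ∫ u in (-(h : ℝ))..h, K i u with hm0r
  have hm0 : ∀ i, 1 ≤ i → i < 2 * m → MI.mem S (m0r i) ((mu i).getD 0 default) := by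
    intro i hi1 hi2
    have := hmu i hi1 hi2 0 (by omega)
    simpa [hm0r, hK] using this
  -- the integrand and its panel forms
  set F : ℝ → ℝ → ℝ := fun ρ t ↦ weilArchDensityG t * ((2 * g (y0 + ρ) - g (y0 + ρ - t) - g (y0 + ρ + t)) / t) with hF
  have hFint : ∀ ρ (a b : ℝ), 0 ≤ a → a ≤ b → IntervalIntegrable (F ρ) volume a b := fun ρ a b ha hab ↦
    intervalIntegrable_weilArchDensityG_mul ha hab (continuous_symmDiff_div hexp0 ρ)
  have hFpanel : ∀ i, 1 ≤ i → ∀ ρ u, -(h : ℝ) ≤ u →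
      F ρ (tI i + u) = K i u * (2 * g (y0 + ρ) - g ((y0 - tI i) + (ρ + (-1 : ℤ) * u)) -
        g ((y0 + tI i) + (ρ + (1 : ℤ) * u))) := by
    intro i hi ρ u hu
    have e1 : y0 + ρ - (tI i + u) = (y0 - tI i) + (ρ + ((-1 : ℤ) : ℝ) * u) := by push_cast; ring
    have e2 : y0 + ρ + (tI i + u) = (y0 + tI i) + (ρ + ((1 : ℤ) : ℝ) * u) := by push_cast; ring
    simp only [hF, hK]
    rw [dt_G_mul_div (t := tI i + u) (dt_tI_add_pos hc hm hi hu), e1, e2]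
  -- tables at the two kinds of base points
  have htabM : ∀ i, 1 ≤ i → i ≤ m + k →
      TabOK S (2 * h) (fun s ↦ g ((y0 - tI i) + s)) (tab ((k : ℤ) - i)).1 (tab ((k : ℤ) - i)).2.1 (tab ((k : ℤ) - i)).2.2 ∧
      (tab ((k : ℤ) - i)).1.length = Dl + 1 := by
    intro i hi1 hi2
    have hn1 : -(m : ℤ) ≤ (k : ℤ) - i := by omega
    have hn2 : (k : ℤ) - i ≤ m := by omega
    have e : (fun s ↦ g (2 * (((k : ℤ) - i : ℤ) : ℝ) * (h : ℝ) + s)) = fun s ↦ g ((y0 - tI i) + s) := by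
      funext s; rw [dt_base_minus]
    have := htab _ hn1 hn2
    rw [e] at this
    exact ⟨this, htabl _ hn1 hn2⟩
  have htabP : ∀ i, 1 ≤ i → i ≤ jn →
      TabOK S (2 * h) (fun s ↦ g ((y0 + tI i) + s)) (tab ((k : ℤ) + i + 1)).1 (tab ((k : ℤ) + i + 1)).2.1
        (tab ((k : ℤ) + i + 1)).2.2 ∧ (tab ((k : ℤ) + i + 1)).1.length = Dl + 1 := by
    intro i hi1 hi2
    have hn1 : -(m : ℤ) ≤ (k : ℤ) + i + 1 := by omega
    have hn2 : (k : ℤ) + i + 1 ≤ m := by omega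
    have e : (fun s ↦ g (2 * (((k : ℤ) + i + 1 : ℤ) : ℝ) * (h : ℝ) + s)) = fun s ↦ g ((y0 + tI i) + s) := by
      funext s; rw [dt_base_plus]
    have := htab _ hn1 hn2
    rw [e] at this
    exact ⟨this, htabl _ hn1 hn2⟩
  have hKi : ∀ i, 1 ≤ i → IntervalIntegrable (K i) volume (-(h : ℝ)) h := fun i hi ↦ dt_intervalIntegrable_K hc hm hi
  have hK0 : ∀ i, 1 ≤ i → ∀ u ∈ Icc (-(h : ℝ)) h, 0 ≤ K i u := fun i hi ↦ dt_K_nonneg hc hm hi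
  have hmu' : ∀ i, 1 ≤ i → i < 2 * m → ∀ (L : ℕ), L = Dl + 1 → ∀ b, b < L →
      MI.mem S (∫ u in (-(h : ℝ))..h, K i u * u ^ b) ((mu i).getD b default) := by
    intro i hi1 hi2 L hL b hb; subst hL; exact hmu i hi1 hi2 b hb
  have hgc : ∀ b0 : ℝ, Continuous fun s ↦ g (b0 + s) := fun b0 ↦ hg.comp (continuous_const.add continuous_id)
  -- (a) panel 0
  have hP0 : TMem S h (fun ρ ↦ ∫ t in (0 : ℝ)..(2 * (h : ℝ)), F ρ t) (panel0I S A0 M0) :=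
    tmem_panel0 hS h (intervalIntegrable_weilArchDensityG le_rfl (by linarith)) has0 hexp0 hM0
  -- (b) full panels
  have hfull : ∀ i, i < jn → 1 ≤ i → TMem S h (fun ρ ↦ ∫ u in (-(h : ℝ))..h, F ρ (tI i + u))
      (tsubI (tsubI (tsmulI S ((mu i).getD 0 default) (tsmulInt 2 Gy))
        (widen0 (contrI S (tab ((k : ℤ) - i)).1 (mu i) (-1))
          ⌈(((tab ((k : ℤ) - i)).2.1 * ((mu i).getD 0 default).hi : ℤ) : ℚ) / S⌉))
        (widen0 (contrI S (tab ((k : ℤ) + i + 1)).1 (mu i) 1)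
          ⌈(((tab ((k : ℤ) + i + 1)).2.1 * ((mu i).getD 0 default).hi : ℤ) : ℚ) / S⌉)) := by
    intro i hij hi1
    have hi2 : i < 2 * m := by omega
    obtain ⟨hTm, hLm⟩ := htabM i hi1 (by omega)
    obtain ⟨hTp, hLp⟩ := htabP i hi1 hij.le
    have T1 := tmem_smulI hS (hm0 i hi1 hi2) (tmem_smulInt 2 hGy)
    have T2 := tmem_contrI hS hhr' le_rfl hTm (hgc _) (hKi i hi1) (hK0 i hi1) (hmu' i hi1 hi2 _ hLm)
      (by omega) (sgn := -1) (Or.inr rfl)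
    have T3 := tmem_contrI hS hhr' le_rfl hTp (hgc _) (hKi i hi1) (hK0 i hi1) (hmu' i hi1 hi2 _ hLp)
      (by omega) (sgn := 1) (Or.inl rfl)
    refine tmem_congr_on (tmem_sub (tmem_sub T1 T2) T3) fun ρ hρ ↦ ?_
    -- the value identity on panel `i`
    have hcongr : ∫ u in (-(h : ℝ))..h, F ρ (tI i + u) = ∫ u in (-(h : ℝ))..h,
        K i u * (2 * g (y0 + ρ) - g ((y0 - tI i) + (ρ + (-1 : ℤ) * u)) - g ((y0 + tI i) + (ρ + (1 : ℤ) * u))) :=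
      intervalIntegral.integral_congr fun u hu ↦ hFpanel i hi1 ρ u (by
        rw [Set.uIcc_of_le (by linarith)] at hu; exact hu.1)
    rw [hcongr]
    have hI1 : IntervalIntegrable (fun u ↦ K i u * (2 * g (y0 + ρ))) volume (-(h : ℝ)) h := (hKi i hi1).mul_const _
    have hI2 : IntervalIntegrable (fun u ↦ K i u * g ((y0 - tI i) + (ρ + (-1 : ℤ) * u))) volume (-(h : ℝ)) h :=
      intervalIntegrable_kernel_mul (hKi i hi1) ((hgc _).comp (by fun_prop))
    have hI3 : IntervalIntegrable (fun u ↦ K i u * g ((y0 + tI i) + (ρ + (1 : ℤ) * u))) volume (-(h : ℝ)) h :=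
      intervalIntegrable_kernel_mul (hKi i hi1) ((hgc _).comp (by fun_prop))
    have esplit : ∫ u in (-(h : ℝ))..h, K i u * (2 * g (y0 + ρ) - g ((y0 - tI i) + (ρ + (-1 : ℤ) * u)) -
        g ((y0 + tI i) + (ρ + (1 : ℤ) * u))) =
        (∫ u in (-(h : ℝ))..h, K i u * (2 * g (y0 + ρ))) - (∫ u in (-(h : ℝ))..h, K i u * g ((y0 - tI i) + (ρ + (-1 : ℤ) * u)))
          - ∫ u in (-(h : ℝ))..h, K i u * g ((y0 + tI i) + (ρ + (1 : ℤ) * u)) := by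
      rw [← intervalIntegral.integral_sub hI1 hI2, ← intervalIntegral.integral_sub (hI1.sub hI2) hI3]
      exact intervalIntegral.integral_congr fun u _ ↦ by ring
    rw [esplit, intervalIntegral.integral_mul_const]
    simp only [hm0r]
    push_cast
    ring
  -- (c) fold
  have hfold := tmem_foldl_range (S := S) (h := h) (fun i ↦ 1 ≤ i) hP0 jn fun i hi hp ↦ hfull i hi hp
  -- (d) partial panel `jn`
  obtain ⟨hTm, hLm⟩ := htabM jn hjn1 (by omega)
  obtain ⟨hTp, hLp⟩ := htabP jn hjn1 le_rfl
  have hWjn := hW jn hjn1 hjn2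
  have hpc : TMem S h (fun ρ ↦ ∫ u in (-(h : ℝ))..(((-1 : ℤ) : ℝ) * ρ), K jn u) (partConstI S h (W jn) (pw jn) (-1)) :=
    tmem_partConst hS hhr' (hKi jn hjn1) hWjn (pw jn) (Or.inr rfl)
  have T1 := tmem_smulInt 2 (tmem_mul hS hhr' Dl hGy hpc)
  have T2 := tmem_partVar hS hhr' le_rfl hTm (hgc _) (hKi jn hjn1) (hK0 jn hjn1) hWjn (pw jn) (hm0 jn hjn1 hjn2)
    (sgn := -1) (τ := -1) (Or.inr rfl) (Or.inr rfl)
  have T3 := tmem_partVar hS hhr' le_rfl hTp (hgc _) (hKi jn hjn1) (hK0 jn hjn1) hWjn (pw jn) (hm0 jn hjn1 hjn2)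
    (sgn := 1) (τ := -1) (Or.inl rfl) (Or.inr rfl)
  have hpart := tmem_congr_on (f' := fun ρ ↦ ∫ u in (-(h : ℝ))..(-ρ), F ρ (tI jn + u))
    (tmem_sub (tmem_sub T1 T2) T3) fun ρ hρ ↦ by
    have hρ1 := (abs_le.1 hρ).1
    have hρ2 := (abs_le.1 hρ).2
    have em1 : (((-1 : ℤ) : ℝ) * ρ) = -ρ := by push_cast; ring
    rw [em1]
    have hcongr : ∫ u in (-(h : ℝ))..(-ρ), F ρ (tI jn + u) = ∫ u in (-(h : ℝ))..(-ρ),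
        K jn u * (2 * g (y0 + ρ) - g ((y0 - tI jn) + (ρ + (-1 : ℤ) * u)) - g ((y0 + tI jn) + (ρ + (1 : ℤ) * u))) :=
      intervalIntegral.integral_congr fun u hu ↦ hFpanel jn hjn1 ρ u (by
        rw [Set.uIcc_of_le (by linarith)] at hu; exact hu.1)
    rw [hcongr]
    have hKsub : IntervalIntegrable (K jn) volume (-(h : ℝ)) (-ρ) :=
      (hKi jn hjn1).mono_set (by rw [Set.uIcc_of_le (by linarith), Set.uIcc_of_le (by linarith)];
                                 exact Icc_subset_Icc le_rfl (by linarith))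
    have hI1 : IntervalIntegrable (fun u ↦ K jn u * (2 * g (y0 + ρ))) volume (-(h : ℝ)) (-ρ) := hKsub.mul_const _
    have hI2 : IntervalIntegrable (fun u ↦ K jn u * g ((y0 - tI jn) + (ρ + (-1 : ℤ) * u))) volume (-(h : ℝ)) (-ρ) :=
      hKsub.mul_continuousOn ((hgc _).comp (by fun_prop)).continuousOn
    have hI3 : IntervalIntegrable (fun u ↦ K jn u * g ((y0 + tI jn) + (ρ + (1 : ℤ) * u))) volume (-(h : ℝ)) (-ρ) :=
      hKsub.mul_continuousOn ((hgc _).comp (by fun_prop)).continuousOn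
    have esplit : ∫ u in (-(h : ℝ))..(-ρ), K jn u * (2 * g (y0 + ρ) - g ((y0 - tI jn) + (ρ + (-1 : ℤ) * u)) -
        g ((y0 + tI jn) + (ρ + (1 : ℤ) * u))) =
        (∫ u in (-(h : ℝ))..(-ρ), K jn u * (2 * g (y0 + ρ))) -
          (∫ u in (-(h : ℝ))..(-ρ), K jn u * g ((y0 - tI jn) + (ρ + (-1 : ℤ) * u))) -
          ∫ u in (-(h : ℝ))..(-ρ), K jn u * g ((y0 + tI jn) + (ρ + (1 : ℤ) * u)) := by
      rw [← intervalIntegral.integral_sub hI1 hI2, ← intervalIntegral.integral_sub (hI1.sub hI2) hI3]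
      exact intervalIntegral.integral_congr fun u _ ↦ by ring
    rw [esplit, intervalIntegral.integral_mul_const]
    push_cast
    ring
  -- (e) the decomposition of the set integral
  refine tmem_congr_on (tmem_add hfold hpart) fun ρ hρ ↦ ?_
  have hρ1 := (abs_le.1 hρ).1
  have hρ2 := (abs_le.1 hρ).2
  have hT : (c : ℝ) - (y0 + ρ) = tI jn - ρ := by
    simp only [hy0, htI, hjn]; rw [← dt_c_sub_y0 hk]; ring
  have htIjn : tI jn = (2 * jn + 1) * (h : ℝ) := by simp only [htI]; rw [dt_tI_eq]
  have hjnr : (1 : ℝ) ≤ jn := by exact_mod_cast hjn1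
  have h2jn : (0 : ℝ) ≤ 2 * jn * h := by positivity
  have hTge : 2 * jn * (h : ℝ) ≤ tI jn - ρ := by rw [htIjn]; nlinarith
  rw [hT, ← intervalIntegral.integral_of_le (h2jn.trans hTge)]
  rw [← intervalIntegral.integral_add_adjacent_intervals (hFint ρ 0 (2 * jn * h) le_rfl h2jn)
    (hFint ρ (2 * jn * h) (tI jn - ρ) h2jn hTge)]
  -- full panels
  have epan := intervalIntegral_eq_sum_panels (F ρ) hhr.le (fun a b ha hab ↦ hFint ρ a b ha hab) jn
  rw [epan, dt_sum_range_split0 _ hjn1]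
  -- panel 0 back to `[0, 2h]`
  have e0 : ∫ u in (-(h : ℝ))..h, F ρ ((2 * ((0 : ℕ) : ℝ) + 1) * h + u) = ∫ t in (0 : ℝ)..(2 * (h : ℝ)), F ρ t := by
    have := intervalIntegral.integral_comp_add_right (F ρ) (h : ℝ) (a := -(h : ℝ)) (b := h)
    simp only [Nat.cast_zero, mul_zero, zero_add, one_mul]
    rw [show -(h : ℝ) + h = 0 by ring, show (h : ℝ) + h = 2 * h by ring] at this
    rw [← this]
    exact intervalIntegral.integral_congr fun u _ ↦ by rw [add_comm]
  rw [e0]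
  -- the partial panel back to `u ∈ [-h, -ρ]`
  have epart : ∫ t in (2 * jn * (h : ℝ))..(tI jn - ρ), F ρ t = ∫ u in (-(h : ℝ))..(-ρ), F ρ (tI jn + u) := by
    have := intervalIntegral.integral_comp_add_right (F ρ) (tI jn) (a := -(h : ℝ)) (b := -ρ)
    rw [show -(h : ℝ) + tI jn = 2 * jn * h by rw [htIjn]; ring, show -ρ + tI jn = tI jn - ρ by ring] at this
    rw [← this]
    exact intervalIntegral.integral_congr fun u _ ↦ by rw [add_comm]
  rw [epart]
  -- panels `i ≥ 1`: `(2i+1)h = t_i`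
  have emid : ∑ i ∈ (Finset.range jn).filter (fun i ↦ 1 ≤ i), ∫ u in (-(h : ℝ))..h, F ρ ((2 * (i : ℝ) + 1) * h + u) =
      ∑ i ∈ (Finset.range jn).filter (fun i ↦ 1 ≤ i), ∫ u in (-(h : ℝ))..h, F ρ (tI i + u) := by
    refine Finset.sum_congr rfl fun i _ ↦ ?_
    simp only [htI]; rw [dt_tI_eq]
  rw [emid]

end ArchE

end Summit.RiemannHypothesis.RiemannHypothesis.Theorems.EvenWinsBeyondArch

end
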